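import Summits.RiemannHypothesis.RiemannHypothesis.Theorems.Splittings.RobinFiniteLowHeightCells
import HarnessLib


/-!
# RobinFiniteLowHeightLaw — gen 11 low-height CA law, part 3/4 (C–E): one level at height `T`, the ramps, THE LAW

* C `mertensProdLt_level`: the CA Mertens inequality on the level `[4ᵏ, 4ᵏ⁺¹]`, `11 ≤ k ≤ 17`, at any height `T ≥ 10⁵` with
  `RH(T)`, as soon as `0.0463 + (1 + 2/L1 k)·tailH(T)·2^{k+1} ≤ b_k`;
* D the ramps above `4¹⁸`: `[4¹⁸, 10¹⁴]` and `[10¹⁴, 2·10¹⁹]` against `2.1538` (`G_largeW`; budget excess `≤ 0.0773`, `≤ 0.0904`),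
  `[2·10¹⁹, ∞)` against `2.5422` (`G_large2W`, `Eb_mul_le_box_top`; excess `≤ 0.4526`);
* E `mertensProdLt_low` / **`robinCA_below_low`**: for every natural `X` passing the level conditions of the levels `≤ X` and the
  ramp conditions of the windows `X` reaches, `RH(T)` (`T ≥ 10⁵`) + the three print facts ⟹ `robinCA_below (X + 1)`.
0 `def`; no conjecture in hypothesis position.

HONEST LABEL: SPLITTING SEARCH over kernel-typed RH-EQUIVALENCES; a splitting A ∧ B ⟹ RH is CONDITIONAL
bookkeeping unless A and B are both proved; nothing here bears on the truth of RH.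
-/

set_option linter.dupNamespace false

noncomputable section

open Real Filter Finset
open scoped Chebyshev

namespace Summit.RiemannHypothesis.RiemannHypothesis.Theorems.Splittings.RobinFiniteC1

open Literature.NumberTheory.LFunctions Literature.NumberTheory.DiophantineGeometry
open RobinAnalyticSharp RobinAnalyticSharp.Cells
open Summit.RiemannHypothesis.RiemannHypothesis.Theorems.Splittings.RobinFiniteE3

section LowHeight

/-! ### C · one level of cells at height `T` -/

/-- **The CA Mertens inequality on the level `4ᵏ ≤ P ≤ 4ᵏ⁺¹` (`11 ≤ k ≤ 17`) at ANY verification height `T ≥ 10⁵`** under the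
LEVEL CONDITION `0.0463 + (1 + 2/L1 k)·tailH(T)·2^{k+1} ≤ b_k`: the `θ`-window reaches `4ᵏ⁺¹` (`buthe_range_low`: the level
condition forces `tailH(T)·2^{k+1} ≤ 1/2`), the pointwise lower bound `negLog_le_Eb_point` has budget `≤ b_k`
(`log P ≥ L1 k`, `√P ≤ 2^{k+1}`), and `key_ineq_levelB` closes. -/
theorem mertensProdLt_level (h16 : Buthe2016_thm2) (hB : Buthe2018_thm2_theta)
    (hK : BroadbentEtAl2021_theta_rel_1e19) {T : ℝ} (hT : 100000 ≤ T) (hRH : RiemannHypothesisUpTo T)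
    {k : ℕ} (hk11 : 11 ≤ k) (hk17 : k ≤ 17)
    (hlev : 0.0463 + (1 + 2 / ((L1 k : ℚ) : ℝ)) *
      ((((Real.log (T / (2 * π)) + 1) / (π * T) + (184 + 30 * Real.log T) / T ^ 2)) * 2 ^ (k + 1)) ≤ ((bk k : ℚ) : ℝ))
    {P Q : ℕ} (hPl : 4 ^ k ≤ P) (hPu : P ≤ 4 ^ (k + 1)) (hQP : Q ≤ P) :
    (∏ p ∈ Nat.primesLE P, (1 - (p : ℝ)⁻¹))⁻¹ *
        ∏ p ∈ (Nat.primesLE P).filter (fun p => Q < p), (1 - ((p : ℝ) ^ 2)⁻¹) <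
      rexp eulerMascheroniConstant * Real.log (θ P + θ Q) := by
  have hT0 : 0 < T := by linarith
  have hT7 : (7 : ℝ) ≤ T := by linarith
  have hT20 : (20 : ℝ) ≤ T := by linarith
  have ht0 := Summit.RiemannHypothesis.RiemannHypothesis.Theorems.Splittings.RobinFiniteTail.tailH_nonneg hT7
  obtain ⟨hP₁599, hL₁, -, -, hL₁8, -, -⟩ := range_facts (k := k) (by omega)
  have hPr : (4 : ℝ) ^ k ≤ P := by exact_mod_cast hPl
  have hPur : (P : ℝ) ≤ (4 : ℝ) ^ (k + 1) := by exact_mod_cast hPu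
  have hP599 : (599 : ℝ) ≤ P := hP₁599.trans hPr
  have hP11 : 4 ^ 11 ≤ P := le_trans (Nat.pow_le_pow_right (by norm_num) hk11) hPl
  have hbk : ((bk k : ℚ) : ℝ) ≤ 1 / 2 := by interval_cases k <;> norm_num [bk]
  have hL₁0 : (0 : ℝ) < ((L1 k : ℚ) : ℝ) := by linarith
  have hfac0 : (0 : ℝ) ≤ 2 / ((L1 k : ℚ) : ℝ) := by positivity
  have h2k : √((4 : ℝ) ^ (k + 1)) = 2 ^ (k + 1) := sqrt_four_pow (k + 1)
  -- Büthe's range for `B = 4ᵏ⁺¹`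
  have htu : (((Real.log (T / (2 * π)) + 1) / (π * T) + (184 + 30 * Real.log T) / T ^ 2)) * 2 ^ (k + 1) ≤ 1 / 2 := by
    have h0 : (0 : ℝ) ≤ (((Real.log (T / (2 * π)) + 1) / (π * T) + (184 + 30 * Real.log T) / T ^ 2)) * 2 ^ (k + 1) :=
      mul_nonneg ht0 (by positivity)
    nlinarith
  have hrange : 4.92 * Real.sqrt ((4 : ℝ) ^ (k + 1) / Real.log ((4 : ℝ) ^ (k + 1))) ≤ T := by
    refine buthe_range_low hT0 (pow_le_pow_right₀ (by norm_num) (by omega)) ?_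
    rw [h2k]; exact le_of_tail_budget hT20 (by positivity) htu
  have hW := thetaWindow_low h16 hT0 hRH hrange
  have hlow := negLog_le_Eb_point hB hK hT7 hRH hW hP599 hPur
  -- the pointwise budget is `≤ b_k`
  have hlogP : ((L1 k : ℚ) : ℝ) ≤ Real.log P := hL₁.trans (Real.log_le_log (by positivity) hPr)
  have h2 : 2 / Real.log (P : ℝ) ≤ 2 / ((L1 k : ℚ) : ℝ) := div_le_div_of_nonneg_left (by norm_num) hL₁0 hlogP
  have h2' : (0 : ℝ) ≤ 2 / Real.log (P : ℝ) := div_nonneg (by norm_num) (hL₁0.le.trans hlogP)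
  have hsP : √(P : ℝ) ≤ 2 ^ (k + 1) := by rw [← h2k]; exact Real.sqrt_le_sqrt hPur
  set t : ℝ := (Real.log (T / (2 * π)) + 1) / (π * T) + (184 + 30 * Real.log T) / T ^ 2 with ht_def
  have h3 : t * √(P : ℝ) ≤ t * 2 ^ (k + 1) := mul_le_mul_of_nonneg_left hsP ht0
  have h4 : (1 + 2 / Real.log (P : ℝ)) * (t * √(P : ℝ)) ≤ (1 + 2 / ((L1 k : ℚ) : ℝ)) * (t * 2 ^ (k + 1)) :=
    mul_le_mul (by linarith) h3 (mul_nonneg ht0 (Real.sqrt_nonneg _)) (by linarith)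
  have hbud : 0.0463 + (1 + 2 / Real.log (P : ℝ)) * (t * √(P : ℝ)) ≤ ((bk k : ℚ) : ℝ) := by linarith
  have hkey := key_ineq_levelB hW hk11 hk17 hPl hPu hPur hQP hbud
  exact mertens_prod_lt_of hW hP11 hPur hlow hkey


/-! ### D · the two ramps above `4¹⁸`

For `P ≥ 4¹⁸` no certified cover exists; the key inequality is run on ONE window per regime against the landed
large-branch constants: `2.1538/(√P log P) ≤ G₁ + G₂` for `P ≥ 2·10¹⁰` (`G_largeW`) and `c(L₁)/(√P log P) ≤ G₁ + G₂` for
`P ≥ 2·10¹⁹`, `log P ≥ L₁` (`G_large2W`; `c(44.442) = 2.5422`).  The admissible budget excess over `0.0463`: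
`κ₁a = 0.0773` on `[4¹⁸, 10¹⁴]`, `κ₁b = 0.0904` on `[10¹⁴, 2·10¹⁹]`, `κ₂ = 0.4526` on `[2·10¹⁹, ∞)`. -/

/-- `log 4¹⁸ ∈ [24.95, 24.96]`. -/
theorem log_four_pow_18_bounds : (24.95 : ℝ) ≤ Real.log ((4 : ℝ) ^ 18) ∧ Real.log ((4 : ℝ) ^ 18) ≤ 24.96 := by
  rw [log_four_pow]
  have h := Real.log_two_gt_d9
  have h' := Real.log_two_lt_d9
  constructor <;> push_cast <;> linarith

/-- `log 10¹⁴ ∈ [32.236, 32.24]`. -/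
theorem log_ten_pow_14_bounds : (32.236 : ℝ) ≤ Real.log ((10 : ℝ) ^ 14) ∧ Real.log ((10 : ℝ) ^ 14) ≤ 32.24 := by
  obtain ⟨h1, h2⟩ := log_ten_pow_bounds 14
  constructor <;> push_cast at h1 h2 ⊢ <;> linarith

/-- `log(2·10¹⁹) ∈ [44.442, 44.45]`. -/
theorem log_2e19_bounds : (44.442 : ℝ) ≤ Real.log (2 * (10 : ℝ) ^ 19) ∧ Real.log (2 * (10 : ℝ) ^ 19) ≤ 44.45 := by
  refine ⟨Summit.RiemannHypothesis.RiemannHypothesis.Theorems.Splittings.RobinFiniteE3.log_2e19_gt.le, ?_⟩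
  rw [log_mul_ten_pow (by norm_num) 19]
  have h2 := Real.log_two_lt_d9
  have h10 := RobinAnalytic.log_ten_lt
  push_cast; linarith

/-- **Ramp 1a**: on `[4¹⁸, 10¹⁴]`, `Eb(0.0463 + u)(P)·√P log P < 2.1538` for `0 ≤ u ≤ 0.0773` (β-free box with
`L₁ = 24.95`, `U₁ = 24.96`, `L₂ = 32.24`, `s₁ = 2¹⁸`, `y₁ = 64`; box value `2.15362` at `u = 0.0773`). -/
theorem Eb_ramp1a_lt {P u : ℝ} (h0 : (4 : ℝ) ^ 18 ≤ P) (h1 : P ≤ (10 : ℝ) ^ 14) (hu : u ≤ 0.0773) :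
    (nicolasERH P + ((0.0463 + u) - nicolasBeta) * (1 / (√P * Real.log P) + 1 / (√P * Real.log P ^ 2) + 4 / (√P * Real.log P ^ 3))) *
      (√P * Real.log P) < 2.1538 := by
  obtain ⟨hL, hU⟩ := log_four_pow_18_bounds
  have hL₂ := log_ten_pow_14_bounds.2
  have hs : (262144 : ℝ) ≤ √((4 : ℝ) ^ 18) := by rw [sqrt_four_pow]; norm_num
  have hy : (64 : ℝ) ≤ ((4 : ℝ) ^ 18) ^ ((1 : ℝ) / 6) := le_rpow_sixth (by positivity) (by norm_num)
  have hP1 : (1 : ℝ) < P := lt_of_lt_of_le (by norm_num) h0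
  have hsL : 0 ≤ √P * Real.log P := mul_nonneg (Real.sqrt_nonneg _) (Real.log_pos hP1).le
  have hmono := mul_le_mul_of_nonneg_right (Eb_mono hP1 (show 0.0463 + u ≤ 0.1236 by linarith)) hsL
  have hbox := Eb_mul_le_box (b := 0.1236) (by norm_num) (by norm_num) (by norm_num) h0 h1 hL hU hL₂
    (by norm_num) hs (by norm_num) hy (by norm_num)
  have hnum : ((0.1236 : ℝ) + 2.042) - (2.042 - 0.1236) / 32.24
      + (8.168 + 4 * 0.1236) / 24.95 ^ 2 + 1.84 / 262144 + 2 / 64 + 24.96 ^ 4 / (631.65 * 262144) < 2.1538 := by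
    norm_num
  exact lt_of_le_of_lt (hmono.trans hbox) hnum

/-- **Ramp 1b**: on `[10¹⁴, 2·10¹⁹]`, `Eb(0.0463 + u)(P)·√P log P < 2.1538` for `0 ≤ u ≤ 0.0904` (`L₁ = 32.236`,
`U₁ = 32.24`, `L₂ = 44.45`, `s₁ = 10⁷`, `y₁ = 215`; box value `2.15370` at `u = 0.0904`). -/
theorem Eb_ramp1b_lt {P u : ℝ} (h0 : (10 : ℝ) ^ 14 ≤ P) (h1 : P ≤ 2 * (10 : ℝ) ^ 19) (hu : u ≤ 0.0904) :
    (nicolasERH P + ((0.0463 + u) - nicolasBeta) * (1 / (√P * Real.log P) + 1 / (√P * Real.log P ^ 2) + 4 / (√P * Real.log P ^ 3))) *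
      (√P * Real.log P) < 2.1538 := by
  obtain ⟨hL, hU⟩ := log_ten_pow_14_bounds
  have hL₂ := log_2e19_bounds.2
  have hs : ((10 : ℝ) ^ 7) ≤ √((10 : ℝ) ^ 14) := (sqrt_between (by norm_num) (by norm_num) (u := (10 : ℝ) ^ 7) (by norm_num)).1
  have hy : (215 : ℝ) ≤ ((10 : ℝ) ^ 14) ^ ((1 : ℝ) / 6) := le_rpow_sixth (by positivity) (by norm_num)
  have hP1 : (1 : ℝ) < P := lt_of_lt_of_le (by norm_num) h0
  have hsL : 0 ≤ √P * Real.log P := mul_nonneg (Real.sqrt_nonneg _) (Real.log_pos hP1).le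
  have hmono := mul_le_mul_of_nonneg_right (Eb_mono hP1 (show 0.0463 + u ≤ 0.1367 by linarith)) hsL
  have hbox := Eb_mul_le_box (b := 0.1367) (by norm_num) (by norm_num) (by norm_num) h0 h1 hL hU hL₂
    (by norm_num) hs (by norm_num) hy (by norm_num)
  have hnum : ((0.1367 : ℝ) + 2.042) - (2.042 - 0.1367) / 44.45
      + (8.168 + 4 * 0.1367) / 32.236 ^ 2 + 1.84 / 10 ^ 7 + 2 / 215 + 32.24 ^ 4 / (631.65 * 10 ^ 7) < 2.1538 := by
    norm_num
  exact lt_of_le_of_lt (hmono.trans hbox) hnum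

/-- **Ramp 2**: on `[2·10¹⁹, ∞)`, `Eb(0.0463 + u)(P)·√P log P < 2.5422` for `u ≤ 0.4526` (unbounded box `Eb_mul_le_box_top`
with `U₁ = 44.45`, `s₁ = 4 472 135 000`, `y₁ = 1647`; box value `2.54212` at `u = 0.4526`). -/
theorem Eb_ramp2_lt {P u : ℝ} (h0 : 2 * (10 : ℝ) ^ 19 ≤ P) (hu : u ≤ 0.4526) :
    (nicolasERH P + ((0.0463 + u) - nicolasBeta) * (1 / (√P * Real.log P) + 1 / (√P * Real.log P ^ 2) + 4 / (√P * Real.log P ^ 3))) *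
      (√P * Real.log P) < 2.5422 := by
  obtain ⟨hL, hU⟩ := log_2e19_bounds
  have hs : (4472135000 : ℝ) ≤ √(2 * (10 : ℝ) ^ 19) :=
    (sqrt_between (by norm_num) (by norm_num) (u := (4472136000 : ℝ)) (by norm_num)).1
  have hy : (1647 : ℝ) ≤ (2 * (10 : ℝ) ^ 19) ^ ((1 : ℝ) / 6) := le_rpow_sixth (by positivity) (by norm_num)
  have hP1 : (1 : ℝ) < P := lt_of_lt_of_le (by norm_num) h0
  have hsL : 0 ≤ √P * Real.log P := mul_nonneg (Real.sqrt_nonneg _) (Real.log_pos hP1).le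
  have hmono := mul_le_mul_of_nonneg_right (Eb_mono hP1 (show 0.0463 + u ≤ 0.4989 by linarith)) hsL
  have hbox := Eb_mul_le_box_top (b := 0.4989) (by norm_num) (by norm_num) h0 hL hU (by norm_num) hs (by norm_num)
    hy (by norm_num)
  have hnum : ((0.4989 : ℝ) + 2.042) + 1.84 / 4472135000 + 2 / 1647 + 44.45 ^ 4 / (631.65 * 4472135000) < 2.5422 := by
    norm_num
  exact lt_of_le_of_lt (hmono.trans hbox) hnum

/-- **A ramp window at height `T`, abstractly**: if the pointwise budget excess `(1 + 2/log P)·tailH(T)·√P` is `≤ u ≤ 1/2`,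
`Eb(0.0463 + u)(P)·√P log P < c`, and `c/(√P log P) ≤ G₁ + G₂` on the `θ`-window `[599, P]`, then the CA Mertens
inequality holds at `(P, Q)` — the window reaches `P` by `buthe_range_low`, the lower bound is `negLog_le_Eb_point`. -/
theorem mertens_of_ramp (h16 : Buthe2016_thm2) (hB : Buthe2018_thm2_theta) (hK : BroadbentEtAl2021_theta_rel_1e19)
    {T : ℝ} (hT : 100000 ≤ T) (hRH : RiemannHypothesisUpTo T) {P Q : ℕ} (hP : 4 ^ 11 ≤ P) {u c : ℝ}
    (hu : (1 + 2 / Real.log (P : ℝ)) *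
      ((((Real.log (T / (2 * π)) + 1) / (π * T) + (184 + 30 * Real.log T) / T ^ 2)) * √(P : ℝ)) ≤ u) (hu2 : u ≤ 1 / 2)
    (hlt : (nicolasERH P + ((0.0463 + u) - nicolasBeta) * (1 / (√P * Real.log P) + 1 / (√P * Real.log P ^ 2) + 4 / (√P * Real.log P ^ 3))) *
      (√P * Real.log P) < c)
    (hG : (∀ y : ℝ, 599 ≤ y → y ≤ (P : ℝ) → |θ y - y| ≤ √y * Real.log y ^ 2 / (8 * π)) →
      c / (√(P : ℝ) * Real.log P) ≤
        ∑ p ∈ (Nat.primesLE P).filter (fun p => Q < p), ((p : ℝ) ^ 2)⁻¹ + θ Q / ((θ P + θ Q) * Real.log (θ P + θ Q))) :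
    (∏ p ∈ Nat.primesLE P, (1 - (p : ℝ)⁻¹))⁻¹ *
        ∏ p ∈ (Nat.primesLE P).filter (fun p => Q < p), (1 - ((p : ℝ) ^ 2)⁻¹) <
      rexp eulerMascheroniConstant * Real.log (θ P + θ Q) := by
  have hT0 : 0 < T := by linarith
  have hT7 : (7 : ℝ) ≤ T := by linarith
  have hT20 : (20 : ℝ) ≤ T := by linarith
  have ht0 := Summit.RiemannHypothesis.RiemannHypothesis.Theorems.Splittings.RobinFiniteTail.tailH_nonneg hT7
  have hPr : (4 : ℝ) ^ 11 ≤ P := by exact_mod_cast hP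
  have hP599 : (599 : ℝ) ≤ P := le_trans (by norm_num) hPr
  have hP1 : (1 : ℝ) < P := by linarith
  have hlogP0 : 0 < Real.log (P : ℝ) := Real.log_pos hP1
  have hsL : 0 < √(P : ℝ) * Real.log P := mul_pos (Real.sqrt_pos.2 (by linarith)) hlogP0
  have h1 : (1 : ℝ) ≤ 1 + 2 / Real.log (P : ℝ) := le_add_of_nonneg_right (by positivity)
  have htP : (((Real.log (T / (2 * π)) + 1) / (π * T) + (184 + 30 * Real.log T) / T ^ 2)) * √(P : ℝ) ≤ 1 / 2 :=
    le_trans (le_trans (le_mul_of_one_le_left (mul_nonneg ht0 (Real.sqrt_nonneg _)) h1) hu) hu2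
  have hrange := buthe_range_low hT0 hPr (le_of_tail_budget hT20 (Real.sqrt_nonneg _) htP)
  have hW := thetaWindow_low h16 hT0 hRH hrange
  have hlow := negLog_le_Eb_point hB hK hT7 hRH hW hP599 le_rfl
  have hmono := Eb_mono hP1 (show 0.0463 + (1 + 2 / Real.log (P : ℝ)) *
      ((((Real.log (T / (2 * π)) + 1) / (π * T) + (184 + 30 * Real.log T) / T ^ 2)) * √(P : ℝ)) ≤ 0.0463 + u by linarith)
  exact mertens_prod_lt_of hW hP le_rfl hlow (hmono.trans_lt (((lt_div_iff₀ hsL).2 hlt).trans_le (hG hW)))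


/-! ### E · the law: cells below `4¹⁸`, ramps above -/

/-- **THE LOW-HEIGHT CA MERTENS LAW.**  At ANY verification height `T ≥ 10⁵`: the CA Mertens inequality for
`4¹¹ ≤ P ≤ X`, `Q ≤ P`, provided (cells) every level `4ᵏ ≤ X`, `11 ≤ k ≤ 17`, satisfies its level condition, and (ramps) the
window(s) above `4¹⁸` that `X` reaches satisfy `(1 + 2/log X₀)·tailH(T)·√(min X X₁) ≤ κ`.  Dispatch on `P`: `Nat.log 4 P ≤ 17`
→ `mertensProdLt_level`; `[4¹⁸, 10¹⁴]`, `(10¹⁴, 2·10¹⁹]`, `(2·10¹⁹, X]` → `mertens_of_ramp` with `Eb_ramp1a/1b/2_lt` and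
`G_largeW` / `G_large2W`. -/
theorem mertensProdLt_low (h16 : Buthe2016_thm2) (hB : Buthe2018_thm2_theta)
    (hK : BroadbentEtAl2021_theta_rel_1e19) {T : ℝ} (hT : 100000 ≤ T) (hRH : RiemannHypothesisUpTo T) {X : ℝ}
    (hcell : ∀ k : ℕ, 11 ≤ k → k ≤ 17 → (4 : ℝ) ^ k ≤ X → 0.0463 + (1 + 2 / ((L1 k : ℚ) : ℝ)) *
      ((((Real.log (T / (2 * π)) + 1) / (π * T) + (184 + 30 * Real.log T) / T ^ 2)) * 2 ^ (k + 1)) ≤ ((bk k : ℚ) : ℝ))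
    (hr1a : (4 : ℝ) ^ 18 ≤ X → (1 + 2 / Real.log ((4 : ℝ) ^ 18)) *
      ((((Real.log (T / (2 * π)) + 1) / (π * T) + (184 + 30 * Real.log T) / T ^ 2)) * √(min X ((10 : ℝ) ^ 14))) ≤ 0.0773)
    (hr1b : (10 : ℝ) ^ 14 < X → (1 + 2 / Real.log ((10 : ℝ) ^ 14)) *
      ((((Real.log (T / (2 * π)) + 1) / (π * T) + (184 + 30 * Real.log T) / T ^ 2)) * √(min X (2 * (10 : ℝ) ^ 19))) ≤ 0.0904)
    (hr2 : 2 * (10 : ℝ) ^ 19 < X → (1 + 2 / Real.log (2 * (10 : ℝ) ^ 19)) *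
      ((((Real.log (T / (2 * π)) + 1) / (π * T) + (184 + 30 * Real.log T) / T ^ 2)) * √X) ≤ 0.4526)
    {P Q : ℕ} (hP : 4 ^ 11 ≤ P) (hPX : (P : ℝ) ≤ X) (hQP : Q ≤ P) :
    (∏ p ∈ Nat.primesLE P, (1 - (p : ℝ)⁻¹))⁻¹ *
        ∏ p ∈ (Nat.primesLE P).filter (fun p => Q < p), (1 - ((p : ℝ) ^ 2)⁻¹) <
      rexp eulerMascheroniConstant * Real.log (θ P + θ Q) := by
  have hT7 : (7 : ℝ) ≤ T := by linarith
  have ht0 := Summit.RiemannHypothesis.RiemannHypothesis.Theorems.Splittings.RobinFiniteTail.tailH_nonneg hT7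
  set t : ℝ := (Real.log (T / (2 * π)) + 1) / (π * T) + (184 + 30 * Real.log T) / T ^ 2 with ht_def
  have hPr : (4 : ℝ) ^ 11 ≤ P := by exact_mod_cast hP
  have hP0 : P ≠ 0 := by positivity
  by_cases h18 : P < 4 ^ 18
  · -- CELLS: the level `k = Nat.log 4 P ∈ [11, 17]`
    have hPl : 4 ^ Nat.log 4 P ≤ P := Nat.pow_log_le_self 4 hP0
    have hPu : P < 4 ^ (Nat.log 4 P + 1) := Nat.lt_pow_succ_log_self (by norm_num) P
    have hk11 : 11 ≤ Nat.log 4 P := by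
      by_contra h; push Not at h
      have : 4 ^ (Nat.log 4 P + 1) ≤ 4 ^ 11 := Nat.pow_le_pow_right (by norm_num) (by omega)
      omega
    have hk17 : Nat.log 4 P ≤ 17 := by
      by_contra h; push Not at h
      have : 4 ^ 18 ≤ 4 ^ Nat.log 4 P := Nat.pow_le_pow_right (by norm_num) (by omega)
      omega
    have hkX : (4 : ℝ) ^ Nat.log 4 P ≤ X := le_trans (by exact_mod_cast hPl) hPX
    exact mertensProdLt_level h16 hB hK hT hRH hk11 hk17 (hcell _ hk11 hk17 hkX) hPl hPu.le hQP
  · rw [not_lt] at h18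
    have h18r : (4 : ℝ) ^ 18 ≤ P := by exact_mod_cast h18
    have hX18 : (4 : ℝ) ^ 18 ≤ X := h18r.trans hPX
    have hbig10 : (2 * 10 ^ 10 : ℝ) ≤ P := le_trans (by norm_num) h18r
    have hP1 : (1 : ℝ) < P := lt_of_lt_of_le (by norm_num) h18r
    have hlogP0 : 0 < Real.log (P : ℝ) := Real.log_pos hP1
    have hsP0 : 0 ≤ √(P : ℝ) := Real.sqrt_nonneg _
    -- `2/log P ≤ 2/log X₀` and `√P ≤ √(min X X₁)`: the pointwise excess is under the window's
    have hexcess : ∀ {X₀ X₁ : ℝ}, 1 < X₀ → X₀ ≤ P → (P : ℝ) ≤ X₁ →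
        (1 + 2 / Real.log (P : ℝ)) * (t * √(P : ℝ)) ≤ (1 + 2 / Real.log X₀) * (t * √(min X X₁)) := by
      intro X₀ X₁ hX₀ hX₀P hPX₁
      have hl0 : 0 < Real.log X₀ := Real.log_pos hX₀
      have h2 : 2 / Real.log (P : ℝ) ≤ 2 / Real.log X₀ :=
        div_le_div_of_nonneg_left (by norm_num) hl0 (Real.log_le_log (by linarith) hX₀P)
      have h3 : √(P : ℝ) ≤ √(min X X₁) := Real.sqrt_le_sqrt (le_min hPX hPX₁)
      have h2' : (0 : ℝ) ≤ 2 / Real.log X₀ := by positivity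
      exact mul_le_mul (by linarith) (mul_le_mul_of_nonneg_left h3 ht0) (mul_nonneg ht0 hsP0) (by linarith)
    rcases le_or_gt (P : ℝ) ((10 : ℝ) ^ 14) with h14 | h14
    · -- RAMP 1a `[4¹⁸, 10¹⁴]`
      have hu := hr1a hX18
      exact mertens_of_ramp h16 hB hK hT hRH hP (hexcess (by norm_num) h18r h14) (hu.trans (by norm_num))
        (Eb_ramp1a_lt h18r h14 hu) (fun hW => G_largeW hW hbig10 le_rfl hQP)
    rcases le_or_gt (P : ℝ) (2 * (10 : ℝ) ^ 19) with h19 | h19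
    · -- RAMP 1b `(10¹⁴, 2·10¹⁹]`
      have hu := hr1b (h14.trans_le hPX)
      exact mertens_of_ramp h16 hB hK hT hRH hP (hexcess (by norm_num) h14.le h19) (hu.trans (by norm_num))
        (Eb_ramp1b_lt h14.le h19 hu) (fun hW => G_largeW hW hbig10 le_rfl hQP)
    · -- RAMP 2 `(2·10¹⁹, X]`
      have hu := hr2 (h19.trans_le hPX)
      have hexcess2 : (1 + 2 / Real.log (P : ℝ)) * (t * √(P : ℝ)) ≤ (1 + 2 / Real.log (2 * (10 : ℝ) ^ 19)) * (t * √X) := by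
        have h := hexcess (X₀ := 2 * (10 : ℝ) ^ 19) (X₁ := X) (by norm_num) h19.le hPX
        rwa [min_self] at h
      have hL₁P : (44.442 : ℝ) ≤ Real.log P := log_2e19_bounds.1.trans (Real.log_le_log (by norm_num) h19.le)
      exact mertens_of_ramp h16 hB hK hT hRH hP hexcess2 (hu.trans (by norm_num)) (Eb_ramp2_lt h19.le hu)
        (fun hW => G_large2W hW h19.le le_rfl hQP hL₁P (by norm_num) (c := 2.5422) (by norm_num) (by norm_num))

open scoped ArithmeticFunction.sigma in
/-- **THE LOW-HEIGHT CA-SIDE HEIGHT LAW.  RH verified to ANY height `T ≥ 10⁵` + {Büthe 2016 Thm 2, Büthe 2018 Thm 2,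
BKLNW 2021} ⟹ Robin's inequality at every colossally abundant `N > 5040` all of whose primes are `≤ X`**, for every natural
`X` passing the cell conditions of the levels `≤ X` and the ramp conditions of the windows `X` reaches (bookkeeping of
`robinCA_below_of_height` with `mertensProdLt_low`; primes `< 4¹¹` by the kernel theorem `robinCA_below_four_pow_eleven`).
No conjecture in hypothesis position; nothing here bears on the truth of RH. -/
theorem robinCA_below_low (h16 : Buthe2016_thm2) (hB : Buthe2018_thm2_theta)
    (hK : BroadbentEtAl2021_theta_rel_1e19) {T : ℝ} (hT : 100000 ≤ T) (hRH : RiemannHypothesisUpTo T) {X : ℕ}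
    (hcell : ∀ k : ℕ, 11 ≤ k → k ≤ 17 → (4 : ℝ) ^ k ≤ (X : ℝ) → 0.0463 + (1 + 2 / ((L1 k : ℚ) : ℝ)) *
      ((((Real.log (T / (2 * π)) + 1) / (π * T) + (184 + 30 * Real.log T) / T ^ 2)) * 2 ^ (k + 1)) ≤ ((bk k : ℚ) : ℝ))
    (hr1a : (4 : ℝ) ^ 18 ≤ (X : ℝ) → (1 + 2 / Real.log ((4 : ℝ) ^ 18)) *
      ((((Real.log (T / (2 * π)) + 1) / (π * T) + (184 + 30 * Real.log T) / T ^ 2)) * √(min (X : ℝ) ((10 : ℝ) ^ 14))) ≤ 0.0773)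
    (hr1b : (10 : ℝ) ^ 14 < (X : ℝ) → (1 + 2 / Real.log ((10 : ℝ) ^ 14)) *
      ((((Real.log (T / (2 * π)) + 1) / (π * T) + (184 + 30 * Real.log T) / T ^ 2)) * √(min (X : ℝ) (2 * (10 : ℝ) ^ 19))) ≤ 0.0904)
    (hr2 : 2 * (10 : ℝ) ^ 19 < (X : ℝ) → (1 + 2 / Real.log (2 * (10 : ℝ) ^ 19)) *
      ((((Real.log (T / (2 * π)) + 1) / (π * T) + (184 + 30 * Real.log T) / T ^ 2)) * √(X : ℝ)) ≤ 0.4526) :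
    robinCA_below (X + 1) := by
  intro N hCA h5040 hprimes
  obtain ⟨ε, P, Q, -, -, hP, hPN, -, hQP, hpf, -, -, hσ, hθ, -⟩ := hCA.exists_structure
  by_cases hsmall : P < 4 ^ 11
  · refine robinCA_below_four_pow_eleven N hCA h5040 fun p hp hpN => lt_of_le_of_lt ?_ hsmall
    have hN0 : N ≠ 0 := by omega
    have : p ∈ N.primeFactors := Nat.mem_primeFactors.2 ⟨hp, hpN, hN0⟩
    rw [hpf] at this
    exact (Nat.mem_primesLE.1 this).1
  · rw [not_lt] at hsmall
    have hPX : (P : ℝ) ≤ X := by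
      have := hprimes P hP hPN
      exact_mod_cast Nat.lt_succ_iff.1 this
    have hlt := mertensProdLt_low h16 hB hK hT hRH hcell hr1a hr1b hr2 hsmall hPX hQP
    have hN0 : N ≠ 0 := by omega
    have hNpos : (0 : ℝ) < N := by exact_mod_cast Nat.pos_of_ne_zero hN0
    have hθpos : 0 < θ P + θ Q := by
      have h1 : 0 < θ (P : ℝ) := Chebyshev.theta_pos (by exact_mod_cast hP.two_le)
      have h2 : 0 ≤ θ (Q : ℝ) := Chebyshev.theta_nonneg _
      linarith
    have hlog : Real.log (θ P + θ Q) ≤ Real.log (Real.log N) := Real.log_le_log hθpos hθ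
    have hlt' : (σ 1 N : ℝ) / N < rexp eulerMascheroniConstant * Real.log (Real.log N) :=
      lt_of_le_of_lt hσ (hlt.trans_le (mul_le_mul_of_nonneg_left hlog (Real.exp_pos _).le))
    unfold robinInequality
    rw [div_lt_iff₀ hNpos] at hlt'
    linarith

end LowHeight

end Summit.RiemannHypothesis.RiemannHypothesis.Theorems.Splittings.RobinFiniteC1

end
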